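import Literature.Topology.FourManifolds.OneHandleStepPair
import Literature.Topology.FourManifolds.OneHandleStepData
import Literature.Topology.FourManifolds.OneHandleStepMatch
import Literature.Topology.FourManifolds.LickorishWallaceLeaves
import Literature.Topology.FourManifolds.GradientLikeExistence
import Literature.Topology.FourManifolds.HandleAttachmentNormalisation
import Literature.Topology.FourManifolds.HandleHeightMatching
import HarnessLib

/-!
# The handle-extension step for one `1`-handle: existence of the context, and the discharges

Topic `Literature/Topology/FourManifolds` (fact seat
`provefact-Literature.Topology.FourManifolds.IsHandlebody.exists_diffeomorph_isBoundaryGluing_sphere`,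
step F2b₁ of the Lickorish–Wallace DAG).  Everything here is **proved**; no named facts.  This
file closes the DAG:

* `levelStep` — the level step H of `HandleAttachmentNormalisation.lean`
  (`oneHandle_nonempty_diffeomorph_of_levelStep`): from the hypotheses of H the context
  `OneHandleStepContext` is built — common gap below the levels (`exists_common_gap`), heights
  matched (`HandleHeightMatching.lean`), Morse charts of index `1` (`MorseLemma.lean`), the
  chart of `M'` reflected when needed (`MorseChartReflect.lean`; the decision is read on
  flow-independent data, `OneHandleStepMatch.lean`), handle sides with the field of `M` pulled
  back from that of `M'` on the seed collar (`HandleSideConstruction.lean`,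
  `SublevelDiffeoAmbient.lean`) — and `OneHandleStepContext.nonempty_diffeomorph`
  (`OneHandleStepPair.lean`) gives `M ≅ M'`;
* `oneHandle_nonempty_diffeomorph_holds` — **discharge of L1**
  `Literature.Topology.FourManifolds.oneHandle_nonempty_diffeomorph` (Milnor 1965, Thm. 3.13 for
  one handle of index `1`; Kosinski 1993, VI (6.4)/(7.1));
* `IsHandlebody.exists_diffeomorph_isBoundaryGluing_sphere_holds` — **discharge of F2b₁**
  `Literature.Topology.FourManifolds.IsHandlebody.exists_diffeomorph_isBoundaryGluing_sphere`
  (Lickorish 1962, p. 538: `S³ = H ∪ᵢ H'` for any two handlebodies of the same genus), via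
  `LickorishWallaceLeaves.lean`.

## References

* J. Milnor, *Lectures on the h-cobordism theorem* (1965), Thm. 3.13. [MilnorHCobordism1965]
* A. A. Kosinski, *Differential Manifolds* (1993), VI (6.4), (6.6), (7.1). [Kosinski1993]
* W. B. R. Lickorish, *A representation of orientable combinatorial 3-manifolds*, Ann. of
  Math. 76 (1962), 531–540, p. 538. [LickorishAnnals1962]
-/

open scoped Manifold ContDiff Topology
open Set Function Filter Metric Module

noncomputable section

namespace Literature.Topology.FourManifolds

universe u

/-- Local notation: `𝔼 n` is the model Euclidean space `EuclideanSpace ℝ (Fin n)`. -/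
local notation "𝔼 " n:arg => EuclideanSpace ℝ (Fin n)
/-- Local notation: `ℍ n` is the model half-space `EuclideanHalfSpace n`. -/
local notation "ℍ " n:arg => EuclideanHalfSpace n

/-! ### The level step and the discharges -/

set_option maxHeartbeats 4000000 in
/-- **The level step H** (see `oneHandle_nonempty_diffeomorph_of_levelStep`,
`HandleAttachmentNormalisation.lean`): two compact manifolds with boundary carrying adapted
Morse functions with a single critical point of index `1` above regular levels `b`, `b'`,
identified below these levels by a level-preserving diffeomorphism, with connected level and
orientable, are diffeomorphic. [cite: MilnorHCobordism1965, Thm. 3.13] -/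
theorem levelStep (n : ℕ) (hn : 2 ≤ n) (M M' : Type u)
    [TopologicalSpace M] [T2Space M] [SecondCountableTopology M] [CompactSpace M]
    [ChartedSpace (ℍ (n + 1)) M] [IsManifold (𝓡∂ (n + 1)) ∞ M]
    [TopologicalSpace M'] [T2Space M'] [SecondCountableTopology M'] [CompactSpace M']
    [ChartedSpace (ℍ (n + 1)) M'] [IsManifold (𝓡∂ (n + 1)) ∞ M']
    (F : M → ℝ) (f' : M' → ℝ) (b b' : ℝ) (hF : IsMorseAdapted (𝓡∂ (n + 1)) F)
    (hf' : IsMorseAdapted (𝓡∂ (n + 1)) f')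
    (hintb : ∀ p, F p ≤ b → (𝓡∂ (n + 1)).IsInteriorPoint p)
    (hregb : ∀ p, F p = b → ¬ IsMCriticalPt (𝓡∂ (n + 1)) F p)
    (hintb' : ∀ p, f' p ≤ b' → (𝓡∂ (n + 1)).IsInteriorPoint p)
    (hregb' : ∀ p, f' p = b' → ¬ IsMCriticalPt (𝓡∂ (n + 1)) f' p)
    (hb1 : b < 1) (hb1' : b' < 1)
    (hcritb : ∀ z, IsMCriticalPt (𝓡∂ (n + 1)) F z → F z ≠ b)
    (hexb : ∃! z, IsMCriticalPt (𝓡∂ (n + 1)) F z ∧ b < F z)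
    (hidx : ∀ z, IsMCriticalPt (𝓡∂ (n + 1)) F z → b < F z → morseIndex (𝓡∂ (n + 1)) F z = 1)
    (hcritb' : ∀ z, IsMCriticalPt (𝓡∂ (n + 1)) f' z → f' z ≠ b')
    (hexb' : ∃! z, IsMCriticalPt (𝓡∂ (n + 1)) f' z ∧ b' < f' z)
    (hidx' : ∀ z, IsMCriticalPt (𝓡∂ (n + 1)) f' z → b' < f' z → morseIndex (𝓡∂ (n + 1)) f' z = 1)
    (hconn : IsConnected (F ⁻¹' {b})) (ho : IsOrientable (𝓡∂ (n + 1)) M) (ho' : IsOrientable (𝓡∂ (n + 1)) M') :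
    letI := (sublevelAtlas hF.isMorse.contMDiff b hintb hregb).chartedSpace
    letI := (sublevelAtlas hf'.isMorse.contMDiff b' hintb' hregb').chartedSpace
    ∀ Ψ₁ : ↥(F ⁻¹' Iic b) ≃ₘ⟮𝓡∂ (n + 1), 𝓡∂ (n + 1)⟯ ↥(f' ⁻¹' Iic b'),
      (∀ x : ↥(F ⁻¹' Iic b), f' (Ψ₁ x) = F x + (b' - b)) →
      Nonempty (M ≃ₘ⟮𝓡∂ (n + 1), 𝓡∂ (n + 1)⟯ M') := by
  letI csb := (sublevelAtlas hF.isMorse.contMDiff b hintb hregb).chartedSpace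
  letI csb' := (sublevelAtlas hf'.isMorse.contMDiff b' hintb' hregb').chartedSpace
  haveI := (sublevelAtlas hF.isMorse.contMDiff b hintb hregb).isManifold
  haveI := (sublevelAtlas hf'.isMorse.contMDiff b' hintb' hregb').isManifold
  intro Ψ₁ hΨ₁
  have hn1 : 1 ≤ n := le_trans (by norm_num) hn
  obtain ⟨oM⟩ := ho
  obtain ⟨oM'⟩ := ho'
  /- Step 0: a common gap below the levels `b`, `b'`. -/
  obtain ⟨τ₀, hτ₀, hgap, hgap'⟩ := exists_common_gap hF.isMorse (a := b) hf'.isMorse (a' := b')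
  /- Step 1: heights. -/
  obtain ⟨d, hdpos, hh1, hh1'⟩ : ∃ d : ℝ, 0 < d ∧ b + d < 1 ∧ b' + d < 1 :=
    ⟨(1 - max b b') / 2, by have := max_lt hb1 hb1'; linarith,
      by have := le_max_left b b'; linarith, by have := le_max_right b b'; linarith⟩
  obtain ⟨F₂, hF₂raw, ⟨δF, hδF, hFeq⟩, hFle, hFcrit, -, hFidx, -, hF₂ex, hF₂top⟩ :=
    hF.exists_eq_on_sublevel_apply_eq hcritb hexb (show b < b + d by linarith) hh1
  obtain ⟨f₂, hf₂raw, ⟨δf, hδf, hfeq⟩, hfle, hfcrit, -, hfidx, -, hf₂ex, hf₂top⟩ :=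
    hf'.exists_eq_on_sublevel_apply_eq hcritb' hexb' (show b' < b' + d by linarith) hh1'
  have hF₂ : IsMorseAdapted (𝓡∂ (n + 1)) F₂ := hF₂raw
  have hf₂ : IsMorseAdapted (𝓡∂ (n + 1)) f₂ := hf₂raw
  obtain ⟨p, ⟨hpc, hpb⟩, hpuniq⟩ := hF₂ex
  obtain ⟨p', ⟨hpc', hpb'⟩, hpuniq'⟩ := hf₂ex
  have hFp : F₂ p = b + d := hF₂top p hpc hpb
  have hfp' : f₂ p' = b + d + (b' - b) := by rw [hf₂top p' hpc' hpb']; ring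
  -- function values transfer
  have hFF₂ : ∀ {x}, F x ≤ b → F₂ x = F x := fun {x} hx => hFeq x (by linarith)
  have hff₂ : ∀ {y}, f' y ≤ b' → f₂ y = f' y := fun {y} hy => hfeq y (by linarith)
  have hF₂F : ∀ {x}, F₂ x < b → F x < b := fun {x} hx => by
    rcases ((hFle x).1 hx.le).lt_or_eq with h | h
    · exact h
    · exfalso; rw [hFF₂ h.le, h] at hx; exact lt_irrefl _ hx
  have hf₂f : ∀ {y}, f₂ y < b' → f' y < b' := fun {y} hy => by
    rcases ((hfle y).1 hy.le).lt_or_eq with h | h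
    · exact h
    · exfalso; rw [hff₂ h.le, h] at hy; exact lt_irrefl _ hy
  -- every other critical point is below `b - τ₀` (resp. `b' - τ₀`)
  have hreg₂ : ∀ x, b - τ₀ ≤ F₂ x → x ≠ p → ¬ IsMCriticalPt (𝓡∂ (n + 1)) F₂ x := by
    intro x hx hxp hc
    rcases lt_or_ge b (F₂ x) with hbx | hbx
    · exact hxp (hpuniq x ⟨hc, hbx⟩)
    · have hcF : IsMCriticalPt (𝓡∂ (n + 1)) F x := (hFcrit x).1 hc
      have hFxb : F x ≤ b := (hFle x).1 hbx
      rcases hgap x hcF with hlt | hge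
      · rw [hFF₂ hFxb] at hx; linarith
      · exact hcritb x hcF (le_antisymm hFxb hge)
  have hreg₂' : ∀ y, b + (b' - b) - τ₀ ≤ f₂ y → y ≠ p' → ¬ IsMCriticalPt (𝓡∂ (n + 1)) f₂ y := by
    intro y hy hyp hc
    rcases lt_or_ge b' (f₂ y) with hby | hby
    · exact hyp (hpuniq' y ⟨hc, hby⟩)
    · have hcf : IsMCriticalPt (𝓡∂ (n + 1)) f' y := (hfcrit y).1 hc
      have hfyb : f' y ≤ b' := (hfle y).1 hby
      rcases hgap' y hcf with hlt | hge
      · rw [hff₂ hfyb] at hy; linarith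
      · exact hcritb' y hcf (le_antisymm hfyb hge)
  have hpint : (𝓡∂ (n + 1)).IsInteriorPoint p :=
    ((𝓡∂ (n + 1)).isInteriorPoint_or_isBoundaryPoint p).resolve_right fun hbd => by
      have := (hF₂.2.1 p hbd).1; linarith
  have hpint' : (𝓡∂ (n + 1)).IsInteriorPoint p' :=
    ((𝓡∂ (n + 1)).isInteriorPoint_or_isBoundaryPoint p').resolve_right fun hbd => by
      have := (hf₂.2.1 p' hbd).1; linarith
  /- Step 2: Morse charts of index `1`. -/
  have hidxp : morseIndex (𝓡∂ (n + 1)) F₂ p = 1 := by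
    rw [hFidx p ((hFcrit p).1 hpc)]
    exact hidx p ((hFcrit p).1 hpc) (lt_of_not_ge fun hle => by have := (hFle p).2 hle; linarith)
  have hidxp' : morseIndex (𝓡∂ (n + 1)) f₂ p' = 1 := by
    rw [hfidx p' ((hfcrit p').1 hpc')]
    exact hidx' p' ((hfcrit p').1 hpc') (lt_of_not_ge fun hle => by have := (hfle p').2 hle; linarith)
  obtain ⟨φ₀, hφ₀, hpφ₀, hφ₀int, hφ₀q⟩ := hF₂.isMorse.exists_chart_eq_quadratic_of_isInteriorPoint hpc hpint
  obtain ⟨φ₀', hφ₀', hpφ₀', hφ₀int', hφ₀q'⟩ := hf₂.isMorse.exists_chart_eq_quadratic_of_isInteriorPoint hpc' hpint'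
  have hfq : ∀ q ∈ φ₀.source, F₂ q = F₂ p + milnorQuadratic 1 (φ₀.extend (𝓡∂ (n + 1)) q - φ₀.extend (𝓡∂ (n + 1)) p) := by
    intro q hq
    rw [hφ₀q q hq, hidxp, milnorQuadratic]
    simp only [OpenPartialHomeomorph.extend_coe, Function.comp_apply, PiLp.sub_apply]
    ring
  have hfq' : ∀ q ∈ φ₀'.source, f₂ q = f₂ p' + milnorQuadratic 1 (φ₀'.extend (𝓡∂ (n + 1)) q - φ₀'.extend (𝓡∂ (n + 1)) p') := by
    intro q hq
    rw [hφ₀q' q hq, hidxp', milnorQuadratic]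
    simp only [OpenPartialHomeomorph.extend_coe, Function.comp_apply, PiLp.sub_apply]
    ring
  have htgt : ∀ {N : Type u} [TopologicalSpace N] [ChartedSpace (ℍ (n + 1)) N] (φ : OpenPartialHomeomorph N (ℍ (n + 1)))
      {q : N} (_ : q ∈ φ.source) (_ : (𝓡∂ (n + 1)) (φ q) ∈ interior (range (𝓡∂ (n + 1)))),
      ∃ ε₁ > 0, closedBall (φ.extend (𝓡∂ (n + 1)) q) (6 * ε₁) ⊆ (φ.extend (𝓡∂ (n + 1))).target := by
    intro N _ _ φ q hq hqi
    have hmem : (φ.extend (𝓡∂ (n + 1))).target ∈ 𝓝 (φ.extend (𝓡∂ (n + 1)) q) := by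
      rw [OpenPartialHomeomorph.extend_target]
      refine Filter.inter_mem ?_ (mem_interior_iff_mem_nhds.1 hqi)
      exact (φ.open_target.preimage (𝓡∂ (n + 1)).continuous_symm).mem_nhds (by
        show (𝓡∂ (n + 1)).symm ((𝓡∂ (n + 1)) (φ q)) ∈ φ.target
        rw [(𝓡∂ (n + 1)).left_inv]; exact φ.map_source hq)
    obtain ⟨ε₂, hε₂, hball⟩ := Metric.mem_nhds_iff.1 hmem
    refine ⟨ε₂ / 12, by positivity, fun u hu => hball ?_⟩
    rw [mem_closedBall] at hu; rw [mem_ball]; linarith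
  obtain ⟨ε₁, hε₁, hball₁⟩ := htgt φ₀ hpφ₀ (hφ₀int p hpφ₀)
  obtain ⟨ε₁', hε₁', hball₁'⟩ := htgt φ₀' hpφ₀' (hφ₀int' p' hpφ₀')
  -- the chart scale
  obtain ⟨ε, hεpos, hεε₁, hεε₁', hε4, hε30, hεh1, hεh1'⟩ : ∃ ε : ℝ, 0 < ε ∧ ε ≤ ε₁ ∧ ε ≤ ε₁' ∧ ε ≤ 1 / 4 ∧
      30 * ε ^ 2 ≤ b + d - b ∧ b + d + 17 * ε ^ 2 < 1 ∧ b + d + (b' - b) + 17 * ε ^ 2 < 1 := by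
    refine ⟨min (min ε₁ ε₁') (min (1 / 4) (min (d / 30) (min ((1 - (b + d)) / 18) ((1 - (b' + d)) / 18)))), ?_⟩
    set e := min (min ε₁ ε₁') (min (1 / 4) (min (d / 30) (min ((1 - (b + d)) / 18) ((1 - (b' + d)) / 18)))) with he
    have hepos : 0 < e := lt_min (lt_min hε₁ hε₁') (lt_min (by norm_num) (lt_min (by linarith) (lt_min (by linarith) (by linarith))))
    have he4 : e ≤ 1 / 4 := (min_le_right _ _).trans (min_le_left _ _)
    have hed : e ≤ d / 30 := (min_le_right _ _).trans ((min_le_right _ _).trans (min_le_left _ _))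
    have heh : e ≤ (1 - (b + d)) / 18 := (min_le_right _ _).trans ((min_le_right _ _).trans ((min_le_right _ _).trans (min_le_left _ _)))
    have heh' : e ≤ (1 - (b' + d)) / 18 := (min_le_right _ _).trans ((min_le_right _ _).trans ((min_le_right _ _).trans (min_le_right _ _)))
    have hesq : e ^ 2 ≤ e := by
      have := mul_le_mul_of_nonneg_left (show e ≤ 1 by linarith) hepos.le
      rw [pow_two]; linarith
    exact ⟨hepos, (min_le_left _ _).trans (min_le_left _ _), (min_le_left _ _).trans (min_le_right _ _), he4,
      by linarith, by linarith, by linarith⟩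
  have hball5 : closedBall (φ₀.extend (𝓡∂ (n + 1)) p) (5 * ε) ⊆ (φ₀.extend (𝓡∂ (n + 1))).target :=
    (closedBall_subset_closedBall (by linarith)).trans hball₁
  have hball6' : closedBall (φ₀'.extend (𝓡∂ (n + 1)) p') (6 * ε) ⊆ (φ₀'.extend (𝓡∂ (n + 1))).target :=
    (closedBall_subset_closedBall (by linarith)).trans hball₁'
  have hball5' : closedBall (φ₀'.extend (𝓡∂ (n + 1)) p') (5 * ε) ⊆ (φ₀'.extend (𝓡∂ (n + 1))).target :=
    (closedBall_subset_closedBall (by linarith)).trans hball6'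
  /- The seed maps. -/
  set σ : ℝ := b' - b with hσ
  have hg₀ : ∀ x, F₂ x < b - τ₀ / 4 → ContMDiffAt (𝓡∂ (n + 1)) (𝓡∂ (n + 1)) ∞ (amb Ψ₁ p') x := fun x hx =>
    contMDiffAt_amb (Ψ₀ := Ψ₁) (d := p') hn1 rfl rfl (hF₂F (by linarith))
  have hg₀' : ∀ y, f₂ y < b + σ - τ₀ / 4 → ContMDiffAt (𝓡∂ (n + 1)) (𝓡∂ (n + 1)) ∞ (ambInv Ψ₁ p) y := fun y hy =>
    contMDiffAt_ambInv (Ψ₀ := Ψ₁) (d₀ := p) hn1 rfl rfl (hf₂f (by rw [hσ] at hy; linarith))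
  have hlev₀ : ∀ x, F₂ x ≤ b - τ₀ / 4 → f₂ (amb Ψ₁ p' x) = F₂ x + σ := by
    intro x hx
    have hFx : F x ≤ b := (hFle x).1 (by linarith)
    have h2 : f' (Ψ₁ ⟨x, hFx⟩) = F x + σ := hΨ₁ ⟨x, hFx⟩
    show f₂ (sublevelAmbient Ψ₁ p' x) = F₂ x + σ
    rw [sublevelAmbient_apply hFx, hff₂ (by rw [h2]; linarith), h2, hFF₂ hFx]
  have hlev₀' : ∀ y, f₂ y ≤ b + σ - τ₀ / 4 → F₂ (ambInv Ψ₁ p y) = f₂ y - σ := by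
    intro y hy
    have hfy : f' y ≤ b' := (hfle y).1 (by rw [hσ] at hy; linarith)
    have h2 : f' (Ψ₁ (Ψ₁.symm ⟨y, hfy⟩)) = F (Ψ₁.symm ⟨y, hfy⟩).1 + σ := hΨ₁ _
    rw [Diffeomorph.apply_symm_apply] at h2
    have h3 : f' y = F (Ψ₁.symm ⟨y, hfy⟩).1 + σ := h2
    show F₂ (sublevelAmbient Ψ₁.symm p y) = _
    rw [sublevelAmbient_apply hfy, hFF₂ (Ψ₁.symm ⟨y, hfy⟩).2, hff₂ hfy]; linarith
  have hinv₀ : ∀ x, F₂ x ≤ b - τ₀ / 4 → ambInv Ψ₁ p (amb Ψ₁ p' x) = x := fun x hx =>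
    sublevelAmbient_symm_apply Ψ₁ ((hFle x).1 (by linarith))
  have hinv₀' : ∀ y, f₂ y ≤ b + σ - τ₀ / 4 → amb Ψ₁ p' (ambInv Ψ₁ p y) = y := by
    intro y hy
    have hfy : f' y ≤ b' := (hfle y).1 (by rw [hσ] at hy; linarith)
    show sublevelAmbient Ψ₁ p' (sublevelAmbient Ψ₁.symm p y) = y
    rw [sublevelAmbient_apply hfy, sublevelAmbient_apply (Ψ₁.symm ⟨y, hfy⟩).2]
    simp
  have hUmem : ∀ {x}, F₂ x < b - τ₀ / 4 → F x < b ∧ f' (amb Ψ₁ p' x) < b' := fun {x} hx => by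
    have hFx : F x < b := hF₂F (by linarith)
    refine ⟨hFx, ?_⟩
    have h2 : f' (Ψ₁ ⟨x, hFx.le⟩) = F x + σ := hΨ₁ ⟨x, hFx.le⟩
    show f' (sublevelAmbient Ψ₁ p' x) < b'
    rw [sublevelAmbient_apply hFx.le, h2, hσ]; linarith
  have hpull : ∀ (X' : Π y : M', TangentSpace (𝓡∂ (n + 1)) y),
      ContMDiff (𝓡∂ (n + 1)) (𝓡∂ (n + 1)).tangent ∞ (fun y => (⟨y, X' y⟩ : TangentBundle (𝓡∂ (n + 1)) M')) →
      ∃ ξ₂ : Π x : M, TangentSpace (𝓡∂ (n + 1)) x,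
        ContMDiffOn (𝓡∂ (n + 1)) (𝓡∂ (n + 1)).tangent ∞ (fun x => (⟨x, ξ₂ x⟩ : TangentBundle (𝓡∂ (n + 1)) M)) {x | F₂ x < b - τ₀ / 4} ∧
        (∀ x, F₂ x < b - τ₀ / 4 → mlineDeriv (𝓡∂ (n + 1)) f₂ (amb Ψ₁ p' x) (X' (amb Ψ₁ p' x)) = 1 →
          mlineDeriv (𝓡∂ (n + 1)) F₂ x (ξ₂ x) = 1) ∧
        ∀ x, F₂ x < b - τ₀ / 4 → mfderiv (𝓡∂ (n + 1)) (𝓡∂ (n + 1)) (amb Ψ₁ p') x (ξ₂ x) = X' (amb Ψ₁ p' x) := by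
    intro X' hX'
    refine ⟨fun x => VectorField.mpullback (𝓡∂ (n + 1)) (𝓡∂ (n + 1)) (amb Ψ₁ p') X' x,
      contMDiffOn_mpullback_amb hn1 rfl rfl hX' fun x hx => hUmem hx, fun x hx hunit => ?_, fun x hx => ?_⟩
    · obtain ⟨hFx, hfx⟩ := hUmem hx
      have hevF : F₂ =ᶠ[𝓝 x] F := by
        filter_upwards [(isOpen_lt hF.isMorse.contMDiff.continuous continuous_const).mem_nhds hFx] with y hy
        exact hFF₂ hy.le
      have hevf : f₂ =ᶠ[𝓝 (amb Ψ₁ p' x)] f' := by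
        filter_upwards [(isOpen_lt hf'.isMorse.contMDiff.continuous continuous_const).mem_nhds hfx] with y hy
        exact hff₂ hy.le
      have hev : ∀ᶠ y in 𝓝 x, f' (amb Ψ₁ p' y) = F y + σ := by
        filter_upwards [(isOpen_lt hF.isMorse.contMDiff.continuous continuous_const).mem_nhds hFx] with y hy
        have h2 : f' (Ψ₁ ⟨y, hy.le⟩) = F y + σ := hΨ₁ ⟨y, hy.le⟩
        show f' (sublevelAmbient Ψ₁ p' y) = F y + σ
        rw [sublevelAmbient_apply hy.le, h2]
      have hunit' : mlineDeriv (𝓡∂ (n + 1)) f' (amb Ψ₁ p' x) (X' (amb Ψ₁ p' x)) = 1 := by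
        rw [mlineDeriv_def] at hunit ⊢
        rw [← hevf.mfderiv_eq]; exact hunit
      have h := mlineDeriv_mpullback_amb hn1 rfl rfl X' hFx hfx hev hunit'
      rw [mlineDeriv_def] at h ⊢
      rw [hevF.mfderiv_eq]; exact h
    · obtain ⟨hFx, hfx⟩ := hUmem hx
      exact mfderiv_amb_mpullback hn1 rfl rfl X' hFx hfx
  /- Connectedness of the seed level. -/
  have hconnc : IsConnected (F₂ ⁻¹' {b - τ₀ / 2}) := by
    have h1 : IsConnected (F ⁻¹' {b - τ₀ / 2}) :=
      isConnected_level_sub_of_gap hF.isMorse.contMDiff (a' := b) (by linarith)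
        (fun y hy => (hgap y hy).imp (fun h => by linarith) id) hregb hintb hconn
    have hset : F₂ ⁻¹' {b - τ₀ / 2} = F ⁻¹' {b - τ₀ / 2} := by
      ext x
      simp only [mem_preimage, mem_singleton_iff]
      constructor
      · intro hx
        have hFx : F x ≤ b := (hFle x).1 (by rw [hx]; linarith)
        rw [← hFF₂ hFx, hx]
      · intro hx
        rw [hFF₂ (by rw [hx]; linarith), hx]
    rw [hset]; exact h1
  /- The two candidate contexts and the decision. -/
  have hR₀ : (0 : ℝ) < 6 * ε := by linarith
  let φr := MorseChartReflect.reflectChart φ₀' p' (6 * ε) hball6'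
  have hcen : φr.extend (𝓡∂ (n + 1)) p' = φ₀'.extend (𝓡∂ (n + 1)) p' :=
    MorseChartReflect.extend_reflectChart_self φ₀' p' (6 * ε) hball6' hpφ₀' hR₀
  have hballr : closedBall (φr.extend (𝓡∂ (n + 1)) p') (5 * ε) ⊆ (φr.extend (𝓡∂ (n + 1))).target := by
    rw [hcen]; exact MorseChartReflect.closedBall_subset_reflectChart_target φ₀' p' (6 * ε) hball6' (by linarith)
  have hbh : b < b + d := by linarith
  have hh1₀' : b + d + σ < 1 := by rw [hσ]; linarith
  have hε30' : 30 * ε ^ 2 ≤ b + d + σ - (b + σ) := by linarith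
  have hfeetr : ∀ w : 𝔼 n, (φr.extend (𝓡∂ (n + 1))).symm (φr.extend (𝓡∂ (n + 1)) p' +
      footModel n 1 (f₂ p' - (b + d + σ - ε ^ 2 / 2)) (ε / 5) w) =
      (φ₀'.extend (𝓡∂ (n + 1))).symm (φ₀'.extend (𝓡∂ (n + 1)) p' + footModel n (-1) (f₂ p' - (b + d + σ - ε ^ 2 / 2)) (ε / 5) w) := by
    intro w
    rw [hcen]
    have hw : φ₀'.extend (𝓡∂ (n + 1)) p' + footModel n 1 (f₂ p' - (b + d + σ - ε ^ 2 / 2)) (ε / 5) w ∈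
        ball (φ₀'.extend (𝓡∂ (n + 1)) p') (6 * ε) := by
      rw [mem_ball, dist_eq_norm, add_sub_cancel_left]
      have := norm_footModel_lt (n := n) (s := 1) (one_pow 2) (by rw [hfp']; have := pow_pos hεpos 2; linarith) (show (0 : ℝ) < ε / 5 by linarith) hεpos
        (show f₂ p' - (b + d + σ - ε ^ 2 / 2) + 2 * (ε / 5) ^ 2 ≤ ε ^ 2 by rw [hfp']; nlinarith) w
      linarith
    exact MorseChartReflect.reflectChart_extend_symm_add_footModel φ₀' p' (6 * ε) hball6' hw
  let L₁ := levelStepData hn hn1 hF₂ hf₂ hFp hfp' hτ₀ hεpos hε4 hε30 hε30' hεh1 hεh1' hbh hh1 hh1₀' hreg₂ hreg₂'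
    hφ₀ hpφ₀ hfq hball5 hφ₀' hpφ₀' hfq' hball5' hφ₀' hpφ₀' hfq' hball5' (one_pow 2) (fun _ => rfl)
    hg₀ hg₀' hlev₀ hlev₀' hinv₀ hinv₀' hpull hconnc oM oM'
  let L₂ := levelStepData hn hn1 hF₂ hf₂ hFp hfp' hτ₀ hεpos hε4 hε30 hε30' hεh1 hεh1' hbh hh1 hh1₀' hreg₂ hreg₂'
    hφ₀ hpφ₀ hfq hball5
    (MorseChartReflect.reflectChart_mem_maximalAtlas φ₀' p' (6 * ε) hball6' hφ₀')
    (MorseChartReflect.mem_reflectChart_source φ₀' p' (6 * ε) hball6' hpφ₀' hR₀)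
    (fun q hq => MorseChartReflect.apply_eq_reflectChart φ₀' p' (6 * ε) hball6' hpφ₀' hR₀ hfq' hq)
    hballr hφ₀' hpφ₀' hfq' hball5' neg_one_sq hfeetr
    hg₀ hg₀' hlev₀ hlev₀' hinv₀ hinv₀' hpull hconnc oM oM'
  let oref : Orientation ℝ (𝔼 n) (Fin (finrank ℝ (𝔼 n))) := (stdOrthonormalBasis ℝ (𝔼 n)).toBasis.orientation
  let SPt : Prop := SeedStatement hF₂ hf₂ hFp hfp' hτ₀ hbh hh1 hh1₀' hreg₂ hreg₂' hg₀ hg₀' hlev₀ hlev₀' hinv₀ hinv₀' oM oM' hn1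
  let At : Prop := FootStatement hF₂ hFp hτ₀ hεpos hε30 hεh1 hreg₂ hφ₀ hpφ₀ hfq hball5 oM hn1 (one_pow 2) oref
  let Bt : Prop := FootStatement hf₂ hfp' hτ₀ hεpos hε30' hεh1' hreg₂' hφ₀' hpφ₀' hfq' hball5' oM' hn1 (one_pow 2) oref
  by_cases hP : SPt ↔ (At ↔ Bt)
  · exact L₁.C.nonempty_diffeomorph (L₁.C.match_of_decision oref
      (L₁.hseed.trans (hP.trans (iff_congr (L₁.hchar oref) (L₁.hchar' oref)).symm)))
  · have hB : FootStatement hf₂ hfp' hτ₀ hεpos hε30' hεh1' hreg₂' hφ₀' hpφ₀' hfq' hball5' oM' hn1 neg_one_sq oref ↔ ¬ Bt :=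
      footStatement_neg_one_iff hf₂ hfp' hτ₀ hεpos hε30' hεh1' hreg₂' hφ₀' hpφ₀' hfq' hball5' oM' hn1 L₂.conn oref
    exact L₂.C.nonempty_diffeomorph (L₂.C.match_of_decision oref
      (L₂.hseed.trans ((iff_not_right_of_not_iff' hP).trans
        (iff_congr (L₂.hchar oref) ((L₂.hchar' oref).trans hB)).symm)))

/-- **Discharge of L1** `Literature.Topology.FourManifolds.oneHandle_nonempty_diffeomorph`: a compact orientable manifold
obtained from an `(n+1)`-disc (`n ≥ 2`) by one handle of index `1` with connected boundary is
determined up to diffeomorphism. [cite: MilnorHCobordism1965, Thm. 3.13; Kosinski1993, VI (6.4), (7.1)] -/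
theorem oneHandle_nonempty_diffeomorph_holds : oneHandle_nonempty_diffeomorph.{u} :=
  oneHandle_nonempty_diffeomorph_of_levelStep levelStep

/-- **Discharge of F2b₁** `Literature.Topology.FourManifolds.IsHandlebody.exists_diffeomorph_isBoundaryGluing_sphere`
(Lickorish 1962, p. 538: for handlebodies `H`, `H'` of the same genus, `S³ = H ∪ᵢ H'` for a
suitable diffeomorphism `i` of the boundaries). [cite: LickorishAnnals1962, p. 538] -/
theorem IsHandlebody.exists_diffeomorph_isBoundaryGluing_sphere_holds :
    IsHandlebody.exists_diffeomorph_isBoundaryGluing_sphere.{u} :=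
  IsHandlebody.exists_diffeomorph_isBoundaryGluing_sphere_of_oneHandle oneHandle_nonempty_diffeomorph_holds

end Literature.Topology.FourManifolds
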